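import Literature.MathematicalPhysics.QuantumFieldTheory.Balaban1983to89.B9Thm313WholeRgdSecondFrom3152
import Literature.MathematicalPhysics.QuantumFieldTheory.Balaban1983to89.B9DivGradStarKinematicsAtPins
import Literature.MathematicalPhysics.QuantumFieldTheory.Balaban1983to89.B9RWSums346SecondDiffGpLeftPairM
import Literature.MathematicalPhysics.QuantumFieldTheory.Balaban1983to89.B9PerturbationMajorantsAtLettersPhys
import Literature.MathematicalPhysics.QuantumFieldTheory.Balaban1983to89.B9RWSums347DefiniteFaces
import Literature.MathematicalPhysics.QuantumFieldTheory.Balaban1983to89.B9RWSumsDefinitePinsPair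
import Literature.MathematicalPhysics.QuantumFieldTheory.Balaban1983to89.B9CoReadingCoordsTranspose
import Literature.MathematicalPhysics.QuantumFieldTheory.Balaban1983to89.B9Thm37GlueTorusCov
import Literature.MathematicalPhysics.QuantumFieldTheory.Balaban1983to89.B9CoReadingCoordsH
import Literature.MathematicalPhysics.QuantumFieldTheory.Balaban1983to89.B9BackgroundsKLevelV1R

/-!
# BalabanUVNodes ∕ N06 ([B9], `Dag.B9_main`) — CASCADE-K «K3-D» (director-ym №383): THE SITE-TRANSPORTER-PARAMETRIC RE-PRESS OF `…N06RgdDsLegAtPinsPhysR`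
# (`hLL2`'s last fields `rgdDs ∕ rgdDd μ₀` at the pins): `rgdDs_rgdDd_of_pinsR_par` = the landed `rgdDs_rgdDd_of_pinsR` VERBATIM with the record's symmetric site
# transporter `parSymY x.toKIdx` replaced by a PARAMETER `parT : ∀ i, SiteParY _ i` in the two transporter-reading pins (`hRco12`: R = `RcoK … (parT) (GpPhysY parT)`;
# `h49`: (3.49) at `PcoK … (parT) (GpY parT)`), and the ONE transporter-specific fact the landed proof used inside — the trace symmetry of `R(U; parT, G′)`
# (`Node00.OpsYSectDCoords.isTransposePair_RcoK`, proved there for `parSymY` from `RY_parSymY_isSymmTr`) — DISPLAYED as the law `hsymRT`, GUARDED by the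
# theorem's own rows-20–21 regime (dag-n06-d's edition-G shape, cell INBOX 2026-08-30 I.20015; node00-def-Y ruling (α) I.19747):
#   `hsymRT : ∀ x, M₁ ≤ (geo9Y x).M → ∀ α₀, 0 < α₀ → (geo9Y x).M·α₀ ≤ a₁ → ∀ U, Reg335 c35 α₀ U → IsSymmTr 1 (RY x (parT x) (GpY x (parT x)) U)`.
# Binder ledger vs the parent: NEW `parT hsymRT`; GONE `hGR` (the class axiom was read only by `isTransposePair_RcoK`); everything else and the conclusion IDENTICAL
# (with `parSymY ↦ parT` at the 2 statement sites).  Instances: `parT := fun i => parSymY i` recovers the parent (law by `isTransposePair_RcoK`'s proof, i.e.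
# `B9Thm311ProjectionR.RY_parSymY_isSymmTr` on the special-unitary class); print's knit transporter `parKnitY` is the knit certificate's Sect.-D network «KD»
# (dag-n06-d g26, HOME `K3D-CENSUS-g25.md` row «400 … RE-PRESS (n06-c)»; law by dag-n06-l's knit symmetry lemmas on (3.35)).
# Seat `pub-ymgap-dag-n06-c` (g25), 2026-08-30.  The parent's module text applies word for word otherwise:
#
# # BalabanUVNodes ∕ N06 ([B9], `Dag.B9_main`) — THE LAST TWO DISPLAYED FIELDS OF `hLL2`: `Letters313L2Pk.rgdDs` (‖1_{Δ(y)}R∇\*_UG₁∇\*_U‖ in block L²) AND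
# # `Letters313L2MZ.rgdDd μ₀` (‖1_{Δ(y)}R∇\*_UG₁∇\*_{U,μ₀}‖) DERIVED AT THE PINS, MEMBER-UNIFORMLY, FROM ROWS 18's SECOND-ORDER LINES OF G′ (`L2SecondLegs37`), THE
# # DISPLAYED IDENTITY (3.152) AND (3.49) — the second-order companion of `…N06RgdILegAtPinsPhysR.rgdI_of_pinsR`
#
# Track A of `YM-PLAN.md` (cell `pub-ymgap`, HUMAN RULING D-0062), node **N06** = [Balaban1985BackgroundPropagators] Thms 3.1–3.15; rows 20–21, seat
# `pub-ymgap-dag-n06-c` (g21; LOCATED-23∕24∕25, INTENT-5∕6∕7, cell INBOX 2026-08-30).  A HELPER for dag-n06-d's certificate editions after ED.93 «UT»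
# (`Summits/…/BalabanUVNodesN06AtOpsYNuOfRecordV6EPairUT`): there `hLL2 : … Letters313L2Pk (𝔬12 x) (𝔡A x).Dd (𝔡A x).Dsd 1 (H x) B13₄ δ12₃ … U ∧ Letters313L2MZ …`
# is DISPLAYED; after dag-n06-l's P-DISP 6 (`gQs ∕ ddGQs ∕ dGQs ∕ q ∕ dGQsd ∕ rgdI`-type fields), this seat's `dv_letters_of_pins` (`gDv ∕ dGDv ∕ dGDvd`), `rgdI_of_pinsR`
# (`rgdI`) and `c1L2_of_pinsR` (`c1`), the ONLY fields of `hLL2` without a supplier were `rgdDs` and `rgdDd` — the words R∘D\*∘G₁∘∇\*_U : bond fns → site fns and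
# R∘D\*∘G₁∘∇\*_{U,μ₀}.
# THE MATHEMATICS ([B9] p. 426 with Thm 3.1).  By (3.152) *"RD\*G₁ = RG′D\*"* both words are R∘G′∘D\*∘E (E = ∇\*_U resp. ∇\*_{U,μ₀}), and D\*_U∘∇\*_U is a sum of
# SECOND covariant derivatives: at node00-def-Y's letters (`B9DivGradStarKinematicsAtPins.GcoS_DvscoKH_DscoK_eq ∕ _DdsB_eq`) G′∘D\*∘∇\*_U =
# `(c_fη)² • Σ_ν Π_ν ∘ Σ_μ slotCopy_μ ∘ (G′∇\*_{U,μ}∇\*_{U,ν}) ∘ dirSliceK μ ν` with `c_fη = 1` (`cf_mul_etaS_of_hcfk`).  Rows 18 carry the per-pair block-L² line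
# ‖1_{Δ(y)}G′∇\*_{U,μ}∇\*_{U,ν}‖ ≦ 2N₃B₃e^{−(1−2α_F)(1−2α)δ₀d} (dag-n06-k∕w1 `l2line5_left_pairM` from `L2SecondLegs37` + structure + the transposition letters, under the
# member facts `lemma21Pack_geo9Y` above a threshold); the slot maps have block-L² letters of every rate (`blockBd_slotCopyK`, `blockBd_dirSliceK` (bI 1-faithful),
# `blockBd_sliceProjK_any`); `B9Thm313WholeRgdSecondFrom3152.blockBd_slotWord` composes them with three row sums (`rowSum261_geo9Y` at margin σS), and
# `rgdE_of_ids3152` finishes with (3.49) (`h49`), R = ϱ(I − P) at the models (`rcoK_GpPhysY ∕ rcoK_eq`, ϱ = c_R⁻¹), Pᵀ = P (from `isTransposePair_RcoK`) and (3.152) (`h152`).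
# THIS FILE ★★ `rgdDs_rgdDd_of_pinsR`: ∃ `Mc ≥ M₁`, `B₄ ≥ B₄₀` such that above `Mc`, in the joint regime `M·α₀ ≤ a₁` (rows 20–21) and `c35·M·α₀ ≤ p.a₁` (rows 18),
# for every member and regular `U`: `rgdDs`'s statement at `(B₄, δ₃)` AND `∀ μ₀, rgdDd μ₀`'s statement at `(B₄, δ₃)` — for any target rate `0 ≤ δ₃ ≤ (1−2α_F)(1−2α)δ₀`
# with `δ₃ + σS ≤ δP`.  Inputs (all items the certificate holds or displays): the pins `hblk12 hblkY12 hblkW12 hDvco12 hDvsco12 hDsco12 hRco12` of `𝔬12`, the A-side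
# direction letter pin (`hDdsA` = the certificate's `h𝔡As`), rows 18's walk records `𝔬 𝔡 𝔩` with pins `hblkS hGpS h𝔡s` (UT: `rfl`), statics `hst hκ hcnt3`, the structure
# conjuncts `h36` (`Local342 ∧ DirSupSq37 ∧ Identities₂`, UT's `h36` + `h36_of_dirSq_pinsR`) and the second-order leg bundle `hL5` (= UT's `(h36H …).2.2.1`), and the
# rows-20–21 displayed `h49`, `h152` (as in `rgdI_of_pinsR`).  The knit (dag-n06-d's pen): with `B13₄ := max B13₄ B₄`, the two fields close and `hLL2` is ASSEMBLED
# from suppliers by anonymous constructor — the binder leaves the display.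
# HONEST FRAMING.  By-name composition of kernel-checked helper files; rows 18's legs, (3.49) and (3.152) are the certificate's displayed∕derived HYPOTHESES, not
# proved here; COUNT-NEUTRAL; nothing of [B9]'s propagator estimates asserted; N06 NOT discharged; K1 NOT closed; one finite 𝕋⁴ programme at fixed `ε` — NOT
# continuum, NOT OS, NOT the mass gap ∕ Clay.  0 `def`, 0 `sorry`.
#
# HONEST FRAMING.  Mechanical re-press of a kernel-checked helper; rows 18's legs, (3.49), (3.152) and the symmetry law are HYPOTHESES; nothing of [B9]
# asserted; COUNT-NEUTRAL; N06 NOT discharged; K1⁹ NOT closed; one finite 𝕋⁴ programme at fixed `ε` — NOT continuum ∕ OS ∕ mass gap ∕ Clay.  0 `def`, 0 `sorry`.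
-/

noncomputable section

namespace Summit.QuantumFields.YangMills.BalabanUVNodes.N06RgdDsLegAtPinsPhysRPar

open Literature.MathematicalPhysics.QuantumFieldTheory.Balaban1983to89
open Literature.MathematicalPhysics.QuantumFieldTheory.Balaban1983to89.Node00
open Literature.MathematicalPhysics.QuantumFieldTheory.Balaban1983to89.B9Thm311ReadingCoords (IsSymmTr)
open Literature.MathematicalPhysics.QuantumFieldTheory.Balaban1983to89.Node00.OpsYSectDCoords (DvcoKH DvscoKH RcoK cR39_trBasis_pos)
open Literature.MathematicalPhysics.QuantumFieldTheory.Balaban1983to89.Node00.OpsYNablaBridge (slotCopyK dirSliceK cf_mul_etaS_of_hcfk)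
open Literature.MathematicalPhysics.QuantumFieldTheory.Balaban1983to89.B9Thm34Ext (toB6)
open Literature.MathematicalPhysics.QuantumFieldTheory.Balaban1983to89.B11SectG (BlockNorm HasMaj RowSum)
open Literature.MathematicalPhysics.QuantumFieldTheory.Balaban1983to89.B9SectDL2Decay (BlockBd)
open Literature.MathematicalPhysics.QuantumFieldTheory.Balaban1983to89.B9Thm37Glue (IsTransposePair isTransposePair_one)
open Literature.MathematicalPhysics.QuantumFieldTheory.Balaban1983to89.B9Thm37GlueTorusCov (isTransposePair_smul)
open Literature.MathematicalPhysics.QuantumFieldTheory.Balaban1983to89.B9Thm312Whole (GeoOK)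
open Literature.MathematicalPhysics.QuantumFieldTheory.Balaban1983to89.B9Thm37Whole (Sizes StaticOK Local342)
open Literature.MathematicalPhysics.QuantumFieldTheory.Balaban1983to89.B9RWSums346SecondDiffGp (DirOps37 DirTranspose37 L2SecondLegs37)
open Literature.MathematicalPhysics.QuantumFieldTheory.Balaban1983to89.B9Thm37WholeDir (DirLetters37 DirSupSq37 Identities₂)
open Literature.MathematicalPhysics.QuantumFieldTheory.Balaban1983to89.B9RWSums346SecondDiffGpLeftPairM (l2line5_left_pairM)
open Literature.MathematicalPhysics.QuantumFieldTheory.Balaban1983to89.B6RandomWalk (c1_nonneg)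
open Literature.MathematicalPhysics.QuantumFieldTheory.Balaban1983to89.B9RWSumsDefinitePins (PinPrims)
open Literature.MathematicalPhysics.QuantumFieldTheory.Balaban1983to89.B9RWSumsDefinitePinsPair (PairPrims)
open Literature.MathematicalPhysics.QuantumFieldTheory.Balaban1983to89.B9RWSums347DefiniteFaces (exp261 lemma21Pack_geo9Y)
open Literature.MathematicalPhysics.QuantumFieldTheory.Balaban1983to89.B9PinMembersKLevelV1 (MemberY geo9Y bg9Y)
open Literature.MathematicalPhysics.QuantumFieldTheory.Balaban1983to89.B9BackgroundsKLevelV1R (RegFamY bg9YR)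
open Literature.MathematicalPhysics.QuantumFieldTheory.Balaban1983to89.B9GeoLemma21KLevelV1 (geo9Y_len_pos geo9Y_dist_triangle geo9Y_dist_comm rowSum261_geo9Y)
open Literature.MathematicalPhysics.QuantumFieldTheory.Balaban1983to89.B9GeoNormsKLevelV1 (geo9K geo9K_dist_nonneg)
open Literature.MathematicalPhysics.QuantumFieldTheory.Balaban1983to89.B7Prop2SpecialUnitary (specialUnitaryUnits)
open Literature.MathematicalPhysics.QuantumFieldTheory.Balaban1983to89.B9CoReadingCoords (XBK blkBK coordOpK cdsBₗ DscoK)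
open Literature.MathematicalPhysics.QuantumFieldTheory.Balaban1983to89.B9CoReadingCoordsH (XHK)
open Literature.MathematicalPhysics.QuantumFieldTheory.Balaban1983to89.B9CoReadingCoordsS (XSK GcoS blkSK sIK)
open Literature.MathematicalPhysics.QuantumFieldTheory.Balaban1983to89.B9CoReadingCoordsTranspose (TrIdx trBasis isTransposePair_coordOpK_of_isSymmTr
  trBasis_repr_eq_trace)
open Literature.MathematicalPhysics.QuantumFieldTheory.Balaban1983to89.B9Thm39ReadingCoords (cR39 cR39_nonneg)
open Literature.MathematicalPhysics.QuantumFieldTheory.Balaban1983to89.B9Ineq349SiteComposite (cdsSL)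
open Literature.MathematicalPhysics.QuantumFieldTheory.Balaban1983to89.B9PerturbationMajorantAlgebra (Proj349Maj)
open Literature.MathematicalPhysics.QuantumFieldTheory.Balaban1983to89.B9PerturbationMajorantsAtLetters (PcoK rcoK_eq)
open Literature.MathematicalPhysics.QuantumFieldTheory.Balaban1983to89.B9PerturbationMajorantsAtLettersPhys (rcoK_GpPhysY)
open Literature.MathematicalPhysics.QuantumFieldTheory.Balaban1983to89.B9Thm313WholeRgdFrom3152 (Ids3152)
open Literature.MathematicalPhysics.QuantumFieldTheory.Balaban1983to89.B9Thm313WholeRgdSecondFrom3152 (blockBd_slotWord rgdE_of_ids3152)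
open Literature.MathematicalPhysics.QuantumFieldTheory.Balaban1983to89.B9DivGradStarKinematicsAtPins (blockBd_slotCopyK blockBd_dirSliceK blockBd_sliceProjK_any
  GcoS_DvscoKH_DscoK_eq GcoS_DvscoKH_DdsB_eq)
open Literature.MathematicalPhysics.QuantumFieldTheory.Balaban1983to89.B9GradViaDivLettersAtPins (rJ sliceProjK)
open Literature.MathematicalPhysics.QuantumFieldTheory.Balaban1983to89.B6GlobalChartV1 (blkV1)
open Literature.MathematicalPhysics.QuantumFieldTheory.Balaban1983to89.B6Ineq2142KLevelV1 (β lvl)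
open Literature.MathematicalPhysics.QuantumFieldTheory.Balaban1983to89.B6Geom246MultiLevelTorus (geomT)
open scoped Matrix.Norms.L2Operator

variable {N : ℕ} [NeZero N]
variable {d ℓ : ℕ} {hd : 1 ≤ d + 1} {hL : Odd (ℓ + 1) ∧ 1 < ℓ + 1} {b₀ b₁ : ℝ} {Mstar : ℕ}
variable [∀ x : MemberY d ℓ hd hL b₀ b₁ Mstar, Fintype (geo9Y x).Site] [∀ x : MemberY d ℓ hd hL b₀ b₁ Mstar, DecidableEq (geo9Y x).Site]

/-- ★★ **`hLL2`'s LAST FIELDS `rgdDs` AND `rgdDd μ₀` AT THE PINS, MEMBER-UNIFORMLY, AT A SITE-TRANSPORTER PARAMETER `parT`** (module docstring): the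
parent `N06RgdDsLegAtPinsPhysR.rgdDs_rgdDd_of_pinsR` with `parSymY ↦ parT` in the pins `hRco12` (R = `RcoK … parT (GpPhysY parT)`) and `h49` ((3.49) at
`PcoK … parT (GpY parT)`), the trace symmetry of `R(U; parT, G′(parT))` DISPLAYED as the guarded law `hsymRT` (rows-20–21 regime `M₁ ≤ M`, `M·α₀ ≤ a₁`,
(3.35)); all other inputs and the conclusion verbatim: ∃ `Mc ≥ M₁`, `B₄ ≥ B₄₀` with, above `Mc` and in both regimes, ‖1_{Δ(y)}R∇\*_UG₁∇\*_Uλ‖₂ ≦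
B₄e^{−δ₃d(y,y′)}‖λ‖₂ and, for every `μ₀`, ‖1_{Δ(y)}R∇\*_UG₁∇\*_{U,μ₀}λ‖₂ ≦ B₄e^{−δ₃d(y,y′)}‖λ‖₂.
[cite: Balaban1985BackgroundPropagators, Thm 3.13 p.426, (3.152)–(3.153) p.426, Thm 3.1 (3.46) p.398 + (3.39) p.397, (3.49) p.399, (3.19) p.393, (3.24)–(3.25) p.394, (3.35) p.396; Balaban1985Averaging, Prop. 2 p.26; Balaban1984PropagatorsII, (2.45)–(2.46) p.231, (2.51)–(2.56) pp.232–233, Lemma 2.1 (2.59)–(2.61) pp.233–234] -/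
theorem rgdDs_rgdDd_of_pinsR_par (parT : ∀ i : B6KLevelCensusIndexV1.KIdx d ℓ hd hL b₀ b₁, Node00.SiteParY (Matrix (Fin N) (Fin N) ℂ) i)
    {R₁ R₂ : RegFamY d ℓ hd hL b₀ b₁ Mstar (Matrix (Fin N) (Fin N) ℂ)}
    (H : MemberY d ℓ hd hL b₀ b₁ Mstar → Prop)
    (bI : ∀ x : MemberY d ℓ hd hL b₀ b₁ Mstar, FBondY x.toKIdx → IBondY x.toKIdx)
    (hβ1 : ∀ (x : MemberY d ℓ hd hL b₀ b₁ Mstar) (f : FBondY x.toKIdx),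
      (geomT x.toKIdx.D).dist (β x.toKIdx.hN x.toKIdx.D x.toKIdx.hk (bI x f)) (blkV1 x.toKIdx.hN x.toKIdx.D f) ≤ 1)
    -- the Sect.-D letter record of rows 20–21 and its pins
    (𝔬12 : ∀ x : MemberY d ℓ hd hL b₀ b₁ Mstar, B9Thm312Whole.Ops (geo9Y x) (bg9YR (Matrix (Fin N) (Fin N) ℂ) (specialUnitaryUnits (Fin N)) R₁ R₂ x)
      (XBK (TrIdx N) x.toKIdx) (XBK (TrIdx N) x.toKIdx) (XHK (TrIdx N) x.toKIdx) (XSK (TrIdx N) x.toKIdx))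
    (hblk12 : ∀ x : MemberY d ℓ hd hL b₀ b₁ Mstar, (𝔬12 x).blk = blkBK x.toKIdx (bI x))
    (hblkY12 : ∀ x : MemberY d ℓ hd hL b₀ b₁ Mstar, (𝔬12 x).blkY = blkBK x.toKIdx (bI x))
    (hblkW12 : ∀ x : MemberY d ℓ hd hL b₀ b₁ Mstar, (𝔬12 x).blkW = blkSK x.toKIdx (sIK x.toKIdx (bI x)))
    (hDvco12 : ∀ (x : MemberY d ℓ hd hL b₀ b₁ Mstar) (U : (bg9YR (Matrix (Fin N) (Fin N) ℂ) (specialUnitaryUnits (Fin N)) R₁ R₂ x).Cfg),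
      (𝔬12 x).Dv U = DvcoKH x.toKIdx (trBasis N) (bg9YR (Matrix (Fin N) (Fin N) ℂ) (specialUnitaryUnits (Fin N)) R₁ R₂ x) (fun U => U) U)
    (hDvsco12 : ∀ (x : MemberY d ℓ hd hL b₀ b₁ Mstar) (U : (bg9YR (Matrix (Fin N) (Fin N) ℂ) (specialUnitaryUnits (Fin N)) R₁ R₂ x).Cfg),
      (𝔬12 x).Dvstar U = DvscoKH x.toKIdx (trBasis N) (bg9YR (Matrix (Fin N) (Fin N) ℂ) (specialUnitaryUnits (Fin N)) R₁ R₂ x) (fun U => U) U)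
    (hDsco12 : ∀ (x : MemberY d ℓ hd hL b₀ b₁ Mstar) (U : (bg9YR (Matrix (Fin N) (Fin N) ℂ) (specialUnitaryUnits (Fin N)) R₁ R₂ x).Cfg),
      (𝔬12 x).Dstar U = DscoK x.toKIdx (trBasis N) (bg9YR (Matrix (Fin N) (Fin N) ℂ) (specialUnitaryUnits (Fin N)) R₁ R₂ x) (fun U => U) U)
    (hRco12 : ∀ (x : MemberY d ℓ hd hL b₀ b₁ Mstar) (U : (bg9YR (Matrix (Fin N) (Fin N) ℂ) (specialUnitaryUnits (Fin N)) R₁ R₂ x).Cfg),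
      (𝔬12 x).R U = RcoK x.toKIdx (trBasis N) (bg9YR (Matrix (Fin N) (Fin N) ℂ) (specialUnitaryUnits (Fin N)) R₁ R₂ x) (fun U => U) (parT x.toKIdx) (GpPhysY x.toKIdx (parT x.toKIdx)) U)
    -- the A-side direction letters ∇*_{U,μ₀} on bond functions (the certificate's `(𝔡A x).Dsd`, pin `h𝔡As`)
    (DdsA : ∀ x : MemberY d ℓ hd hL b₀ b₁ Mstar, (bg9YR (Matrix (Fin N) (Fin N) ℂ) (specialUnitaryUnits (Fin N)) R₁ R₂ x).Cfg → Fin (d + 1) →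
      Module.End ℝ (XBK (TrIdx N) x.toKIdx → ℝ))
    (hDdsA : ∀ (x : MemberY d ℓ hd hL b₀ b₁ Mstar) (U : (bg9YR (Matrix (Fin N) (Fin N) ℂ) (specialUnitaryUnits (Fin N)) R₁ R₂ x).Cfg),
      DdsA x U = fun μ => coordOpK (trBasis N) (fun _ : Fin (d + 1) => cdsBₗ x.toKIdx U μ))
    -- rows 18's walk records at the site pins (UT: `opsWalkY ∕ dirOpsWalkY ∕ dirLettersWalkY`, pins by `rfl`), the G′ model `O`
    {ι : MemberY d ℓ hd hL b₀ b₁ Mstar → Type} [∀ x, Fintype (ι x)]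
    (𝔬 : ∀ x : MemberY d ℓ hd hL b₀ b₁ Mstar, B9Thm37Whole.Ops (geo9Y x) (bg9YR (Matrix (Fin N) (Fin N) ℂ) (specialUnitaryUnits (Fin N)) R₁ R₂ x)
      (XSK (TrIdx N) x.toKIdx) (XSK (TrIdx N) x.toKIdx) (ι x))
    (𝔡 : ∀ x : MemberY d ℓ hd hL b₀ b₁ Mstar, DirOps37 (𝔬 x) (Fin (d + 1))) (𝔩 : ∀ x : MemberY d ℓ hd hL b₀ b₁ Mstar, DirLetters37 (𝔬 x) (Fin (d + 1)))
    (O : ∀ x : MemberY d ℓ hd hL b₀ b₁ Mstar, SiteOpY (Matrix (Fin N) (Fin N) ℂ) x.toKIdx)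
    (hblkS : ∀ x : MemberY d ℓ hd hL b₀ b₁ Mstar, (𝔬 x).blk = blkSK x.toKIdx (sIK x.toKIdx (bI x)))
    (hGpS : ∀ (x : MemberY d ℓ hd hL b₀ b₁ Mstar) (U : (bg9YR (Matrix (Fin N) (Fin N) ℂ) (specialUnitaryUnits (Fin N)) R₁ R₂ x).Cfg),
      (𝔬 x).Gp U = GcoS x.toKIdx (trBasis N) (bg9YR (Matrix (Fin N) (Fin N) ℂ) (specialUnitaryUnits (Fin N)) R₁ R₂ x) (fun U => U) (O x) U)
    (h𝔡s : ∀ (x : MemberY d ℓ hd hL b₀ b₁ Mstar) (U : (bg9YR (Matrix (Fin N) (Fin N) ℂ) (specialUnitaryUnits (Fin N)) R₁ R₂ x).Cfg),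
      (𝔡 x).Dsd U = fun μ => (etaS x.toKIdx)⁻¹ • coordOpK (trBasis N) (fun _ : Fin (d + 1) => (cdsSL x.toKIdx U μ).restrictScalars ℝ))
    (κS : MemberY d ℓ hd hL b₀ b₁ Mstar → Sizes) (S3 : ∀ x : MemberY d ℓ hd hL b₀ b₁ Mstar, ι x → Finset (geo9Y x).Site)
    (p : PinPrims) (hp : p.OK) (p3 : PairPrims) (hp3 : p3.OK) {c35 : ℝ}
    (hst : ∀ x, StaticOK (𝔬 x) p.ρ p.Nc p.N' p.Cℓ (κS x)) (hκ : ∀ x, (κS x).Bounded p.Kc p.θ₀ p.Cℓ (geo9Y x).M)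
    (hcnt3 : ∀ x (a : (geo9Y x).Site), (∑ c, if a ∈ S3 x c then (1 : ℝ) else 0) ≤ p3.N3)
    (h36 : ∀ x, p.M₁ ≤ (geo9Y x).M → ∀ α₀ : ℝ, 0 < α₀ → c35 * (geo9Y x).M * α₀ ≤ p.a₁ →
      ∀ U : (bg9YR (Matrix (Fin N) (Fin N) ℂ) (specialUnitaryUnits (Fin N)) R₁ R₂ x).Cfg, (bg9YR (Matrix (Fin N) (Fin N) ℂ) (specialUnitaryUnits (Fin N)) R₁ R₂ x).Reg335 c35 α₀ U →
        Local342 (𝔬 x) 1 (H x) p.B₀ p.δ₀ U ∧ DirSupSq37 (𝔬 x) (𝔡 x) 1 (H x) U ∧ Identities₂ (𝔬 x) (𝔡 x) (𝔩 x) 1 (H x) U)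
    (hL5 : ∀ x, p.M₁ ≤ (geo9Y x).M → ∀ α₀ : ℝ, 0 < α₀ → c35 * (geo9Y x).M * α₀ ≤ p.a₁ →
      ∀ U : (bg9YR (Matrix (Fin N) (Fin N) ℂ) (specialUnitaryUnits (Fin N)) R₁ R₂ x).Cfg, (bg9YR (Matrix (Fin N) (Fin N) ℂ) (specialUnitaryUnits (Fin N)) R₁ R₂ x).Reg335 c35 α₀ U →
        L2SecondLegs37 (𝔬 x) (𝔡 x) 1 (H x) (S3 x) p3.B3 p.δ₀ U ∧ (∀ q', IsTransposePair ((𝔬 x).Gsq U q') ((𝔬 x).Gsq U q')) ∧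
          (∀ q' μ, IsTransposePair ((𝔩 x).Pt U q' μ) ((𝔩 x).P U q' μ)) ∧ (∀ q', IsTransposePair ((𝔬 x).Ct U q') ((𝔬 x).Cop U q')) ∧
          DirTranspose37 (𝔬 x) (𝔡 x) U)
    -- the rows-20–21 numerics and displayed (3.49), (3.152)
    {M₁ a₁ CP δP σS δ₃ : ℝ} (B₄₀ : ℝ) (hCP : 0 ≤ CP) (hσS : 0 < σS) (hδ₃0 : 0 ≤ δ₃)
    (hδ₃5 : δ₃ ≤ (1 - 2 * p.αF) * ((1 - 2 * p.α) * p.δ₀)) (hδ₃P : δ₃ + σS ≤ δP)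
    (h49 : ∀ x : MemberY d ℓ hd hL b₀ b₁ Mstar, M₁ ≤ (geo9Y x).M → ∀ α₀ : ℝ, 0 < α₀ → (geo9Y x).M * α₀ ≤ a₁ →
      ∀ U : (bg9YR (Matrix (Fin N) (Fin N) ℂ) (specialUnitaryUnits (Fin N)) R₁ R₂ x).Cfg, (bg9YR (Matrix (Fin N) (Fin N) ℂ) (specialUnitaryUnits (Fin N)) R₁ R₂ x).Reg335 c35 α₀ U →
        Proj349Maj (g := geo9Y x) (blkSK x.toKIdx (sIK x.toKIdx (bI x))) (blkBK x.toKIdx (bI x))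
          (PcoK x.toKIdx (trBasis N) (bg9YR (Matrix (Fin N) (Fin N) ℂ) (specialUnitaryUnits (Fin N)) R₁ R₂ x) (fun U => U) (parT x.toKIdx) (GpY x.toKIdx (parT x.toKIdx)) U)
          (DvcoKH x.toKIdx (trBasis N) (bg9YR (Matrix (Fin N) (Fin N) ℂ) (specialUnitaryUnits (Fin N)) R₁ R₂ x) (fun U => U) U)
          (DvscoKH x.toKIdx (trBasis N) (bg9YR (Matrix (Fin N) (Fin N) ℂ) (specialUnitaryUnits (Fin N)) R₁ R₂ x) (fun U => U) U) 1 (H x) CP δP)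
    (h152 : ∀ x : MemberY d ℓ hd hL b₀ b₁ Mstar, M₁ ≤ (geo9Y x).M → ∀ α₀ : ℝ, 0 < α₀ → (geo9Y x).M * α₀ ≤ a₁ →
      ∀ U : (bg9YR (Matrix (Fin N) (Fin N) ℂ) (specialUnitaryUnits (Fin N)) R₁ R₂ x).Cfg, (bg9YR (Matrix (Fin N) (Fin N) ℂ) (specialUnitaryUnits (Fin N)) R₁ R₂ x).Reg335 c35 α₀ U →
        (bg9YR (Matrix (Fin N) (Fin N) ℂ) (specialUnitaryUnits (Fin N)) R₁ R₂ x).Reg336 c35 α₀ U →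
          Ids3152 (𝔬12 x) (fun U => GcoS x.toKIdx (trBasis N) (bg9YR (Matrix (Fin N) (Fin N) ℂ) (specialUnitaryUnits (Fin N)) R₁ R₂ x) (fun U => U) (O x) U) U)
    -- [CASCADE-K «K3-D»] the transporter LAW (parent: `isTransposePair_RcoK` at `parSymY`): `R(U; parT, G′(parT))` trace-symmetric on the rows-20–21 regime
    (hsymRT : ∀ x : MemberY d ℓ hd hL b₀ b₁ Mstar, M₁ ≤ (geo9Y x).M → ∀ α₀ : ℝ, 0 < α₀ → (geo9Y x).M * α₀ ≤ a₁ →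
      ∀ U : (bg9YR (Matrix (Fin N) (Fin N) ℂ) (specialUnitaryUnits (Fin N)) R₁ R₂ x).Cfg, (bg9YR (Matrix (Fin N) (Fin N) ℂ) (specialUnitaryUnits (Fin N)) R₁ R₂ x).Reg335 c35 α₀ U →
        IsSymmTr (fun _ => (1 : ℝ)) (RY x.toKIdx (parT x.toKIdx) (GpY x.toKIdx (parT x.toKIdx)) U)) :
    ∃ (Mc B₄ : ℝ), M₁ ≤ Mc ∧ B₄₀ ≤ B₄ ∧
      ∀ x : MemberY d ℓ hd hL b₀ b₁ Mstar, Mc ≤ (geo9Y x).M → ∀ α₀ : ℝ, 0 < α₀ → (geo9Y x).M * α₀ ≤ a₁ → c35 * (geo9Y x).M * α₀ ≤ p.a₁ →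
        ∀ U : (bg9YR (Matrix (Fin N) (Fin N) ℂ) (specialUnitaryUnits (Fin N)) R₁ R₂ x).Cfg, (bg9YR (Matrix (Fin N) (Fin N) ℂ) (specialUnitaryUnits (Fin N)) R₁ R₂ x).Reg335 c35 α₀ U →
          (bg9YR (Matrix (Fin N) (Fin N) ℂ) (specialUnitaryUnits (Fin N)) R₁ R₂ x).Reg336 c35 α₀ U →
            BlockBd (g := toB6 (geo9Y x) 1 (H x)) (𝔬12 x).blkY (𝔬12 x).blkW ((𝔬12 x).R U ∘ₗ (𝔬12 x).Dvstar U ∘ₗ (𝔬12 x).G1 U ∘ₗ (𝔬12 x).Dstar U)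
                (fun (y y' : (geo9Y x).Site) => B₄ * Real.exp (-(δ₃ * (geo9Y x).dist y y'))) ∧
              ∀ μ₀ : Fin (d + 1), BlockBd (g := toB6 (geo9Y x) 1 (H x)) (𝔬12 x).blk (𝔬12 x).blkW
                ((𝔬12 x).R U ∘ₗ (𝔬12 x).Dvstar U ∘ₗ (𝔬12 x).G1 U ∘ₗ DdsA x U μ₀)
                (fun (y y' : (geo9Y x).Site) => B₄ * Real.exp (-(δ₃ * (geo9Y x).dist y y'))) := by
  classical
  have hN0 : 0 < N := Nat.pos_of_ne_zero (NeZero.ne N)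
  have hc0 : 0 < cR39 (trBasis N) := cR39_trBasis_pos hN0
  have hϱ : 0 ≤ (cR39 (trBasis N))⁻¹ := inv_nonneg.mpr hc0.le
  obtain ⟨hN3, hB3, -⟩ := hp3
  have h2α : 0 ≤ 1 - 2 * p.α := by linarith only [hp.α_lt]
  have hδ5 : 0 ≤ (1 - 2 * p.α) * p.δ₀ := mul_nonneg h2α hp.δ₀_pos.le
  -- rows 18's member facts (Lemma 2.1 of [4] at (δ₀, α); `Facts347` at ((1−2α)δ₀, α_F)) above ONE threshold, and [4] (2.61) at the margin σS
  obtain ⟨Mth, h261, hfacts, -⟩ := lemma21Pack_geo9Y (d := d) (ℓ := ℓ) (hd := hd) (hL := hL) (b₀ := b₀) (b₁ := b₁) (Mstar := Mstar) H hp.α_pos hp.α_lt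
    hp.δ₀_pos hp.αF_pos (by linarith only [hp.αF_lt])
  obtain ⟨ML, c₁, hrow⟩ := rowSum261_geo9Y (d := d) (ℓ := ℓ) (hd := hd) (hL := hL) (b₀ := b₀) (b₁ := b₁) (Mstar := Mstar) σS hσS
  set c : ℝ := max c₁ 0 with hcdef
  have hc : 0 ≤ c := le_max_right _ _
  set L₀ : ℝ := ((ℓ + 1 : ℕ) : ℝ) with hL₀
  -- the walk's largeness threshold of `l2line5_left_pairM`
  set Mbig : ℝ := 2 * p.N' * (p.B₀ * Real.exp (p.δ₀ * p.ρ) * p.θ₀) * Real.sqrt L₀ * B6.c1 (exp261 (@geo9Y d ℓ hd hL b₀ b₁ Mstar) p.δ₀ p.α) p.δ₀ p.α with hMbigdef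
  -- the constants: second-order line C_A, kinematic letters C_E (direction slice), d+1 (slot copy), 1 (slice projection); c_fη = 1
  set CA : ℝ := 2 * (p3.N3 * p3.B3) with hCAdef
  have hCA : 0 ≤ CA := by positivity
  set CE : ℝ := ((d : ℝ) + 1) * Real.exp ((δ₃ + σS) * rJ d ℓ) with hCEdef
  have hCE : 0 ≤ CE := by positivity
  set B₅ : ℝ := |(1 : ℝ)| * (((d + 1 : ℕ) : ℝ) * (1 * ((((d + 1 : ℕ) : ℝ)) * (((d : ℝ) + 1) * (CA * CE * c) * c)) * c)) with hB₅def
  have hB₅ : 0 ≤ B₅ := by positivity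
  set B₄ : ℝ := max B₄₀ ((cR39 (trBasis N))⁻¹ * (B₅ * (1 + CP * c))) with hB₄def
  have hB₄b : (cR39 (trBasis N))⁻¹ * (B₅ * (1 + CP * c)) ≤ B₄ := le_max_right _ _
  refine ⟨max (max M₁ p.M₁) (max Mth (max ML Mbig)), B₄, (le_max_left _ _).trans (le_max_left _ _), le_max_left _ _,
    fun x hM α₀ hα ha hap U hU hU' => ?_⟩
  have hM1x : M₁ ≤ (geo9Y x).M := ((le_max_left _ _).trans (le_max_left _ _)).trans hM
  have hpM1x : p.M₁ ≤ (geo9Y x).M := ((le_max_right _ _).trans (le_max_left _ _)).trans hM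
  have hMthx : Mth ≤ (geo9Y x).M := ((le_max_left _ _).trans (le_max_right _ _)).trans hM
  have hMLx : ML ≤ (geo9Y x).M := (((le_max_left _ _).trans (le_max_right _ _)).trans (le_max_right _ _)).trans hM
  have hMbigx : Mbig ≤ (geo9Y x).M := (((le_max_right _ _).trans (le_max_right _ _)).trans (le_max_right _ _)).trans hM
  have hMpos : 0 < (geo9Y x).M := lt_of_lt_of_le hp.M₁_pos hpM1x
  have hG : GeoOK (geo9Y x) := ⟨geo9Y_dist_triangle x, geo9Y_dist_comm x, geo9K_dist_nonneg x.toKIdx, geo9Y_len_pos x⟩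
  have hrowx : RowSum (toB6 (geo9Y x) 1 (H x)) σS c := fun y => (hrow x hMLx y).trans (le_max_left _ _)
  letI : Fintype (geo9K x.toKIdx).Site := (inferInstance : Fintype (geo9Y x).Site)
  -- rows 18's structure and second-order bundle at this member
  obtain ⟨hloc, hDsq, hids⟩ := h36 x hpM1x α₀ hα hap U hU
  obtain ⟨hL2, hGsqT, hPt, hCt, hDT⟩ := hL5 x hpM1x α₀ hα hap U hU
  -- ONE per-pair second-order line of G′ (rows 18, `l2line5_left_pairM`): ‖1_Δ G′∇*_{U,μ}∇*_{U,ν}‖ ≤ 2N₃B₃ e^{−(1−2α_F)(1−2α)δ₀ d}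
  have hpair : ∀ μ ν : Fin (d + 1), BlockBd (g := toB6 (geo9Y x) 1 (H x)) (𝔬 x).blk (𝔬 x).blk ((𝔬 x).Gp U ∘ₗ ((𝔡 x).Dsd U μ ∘ₗ (𝔡 x).Dsd U ν))
      (fun (a b : (geo9Y x).Site) => 2 * (p3.N3 * p3.B3) * Real.exp (-((1 - 2 * p.αF) * ((1 - 2 * p.α) * p.δ₀) * (geo9Y x).dist a b))) :=
    fun μ ν => l2line5_left_pairM (𝔬 x) (𝔡 x) (𝔩 x) 1 (H x) (exp261 (@geo9Y d ℓ hd hL b₀ b₁ Mstar) ((1 - 2 * p.α) * p.δ₀) (1 - p.αF))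
      (exp261 (@geo9Y d ℓ hd hL b₀ b₁ Mstar) p.δ₀ p.α) ((1 - 2 * p.α) * p.δ₀) p.αF L₀ p.δ₀ p.α p.ρ p.Nc p.N' p.Cℓ p3.N3 p3.B3 p.B₀ p.Kc p.θ₀ (κS x) (S3 x) U
      hp.N'_nn hN3 hB3 hp.B₀_pos.le (le_trans zero_le_one hp.one_le_Cℓ) hp.δ₀_pos.le hp.α_pos.le (mul_nonneg hp.αF_pos.le hδ5)
      (by nlinarith only [hp.αF_lt, hδ5]) le_rfl (hst x) (hκ x) hMpos hMbigx (hcnt3 x) (h261 x hMthx) (hfacts x hMthx) hids hloc hDsq hL2 hDT hGsqT hPt hCt μ ν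
  -- the same at the models: G′ = GcoS … O, ∇*_{U,μ} = η⁻¹ • coordOpK (cdsSL μ), blocks blkSK (sIK bI)
  have hA : ∀ μ ν : Fin (d + 1), BlockBd (g := toB6 (geo9Y x) 1 (H x)) (blkSK x.toKIdx (sIK x.toKIdx (bI x))) (blkSK x.toKIdx (sIK x.toKIdx (bI x)))
      (GcoS x.toKIdx (trBasis N) (bg9YR (Matrix (Fin N) (Fin N) ℂ) (specialUnitaryUnits (Fin N)) R₁ R₂ x) (fun U => U) (O x) U ∘ₗ
        ((etaS x.toKIdx)⁻¹ • coordOpK (trBasis N) (fun _ : Fin (d + 1) => (cdsSL x.toKIdx U μ).restrictScalars ℝ)) ∘ₗ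
        ((etaS x.toKIdx)⁻¹ • coordOpK (trBasis N) (fun _ : Fin (d + 1) => (cdsSL x.toKIdx U ν).restrictScalars ℝ)))
      (fun (a b : (geo9Y x).Site) => CA * Real.exp (-((1 - 2 * p.αF) * ((1 - 2 * p.α) * p.δ₀) * (geo9Y x).dist a b))) := by
    intro μ ν
    have h := hpair μ ν
    rw [hblkS x, hGpS x U, h𝔡s x U] at h
    exact h
  -- the kinematic letters at the rate δ₃ + σS
  have hE : ∀ μ ν : Fin (d + 1), BlockBd (g := toB6 (geo9Y x) 1 (H x)) (blkBK x.toKIdx (bI x)) (blkSK x.toKIdx (sIK x.toKIdx (bI x)))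
      (dirSliceK (κ := TrIdx N) x.toKIdx μ ν) (fun (a b : (geo9Y x).Site) => CE * Real.exp (-((δ₃ + σS) * (geo9Y x).dist a b))) :=
    fun μ ν => blockBd_dirSliceK x.toKIdx (hβ1 x) (by linarith only [hδ₃0, hσS]) 1 (H x) μ ν
  have hCp : ∀ μ : Fin (d + 1), BlockBd (g := toB6 (geo9Y x) 1 (H x)) (blkSK x.toKIdx (sIK x.toKIdx (bI x))) (blkSK x.toKIdx (sIK x.toKIdx (bI x)))
      (slotCopyK (κ := TrIdx N) μ) (fun (a b : (geo9Y x).Site) => ((d : ℝ) + 1) * Real.exp (-((δ₃ + σS) * (geo9Y x).dist a b))) :=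
    fun μ => blockBd_slotCopyK x.toKIdx 1 (H x) (sIK x.toKIdx (bI x)) μ
  have hPr : ∀ ν : Fin (d + 1), BlockBd (g := toB6 (geo9Y x) 1 (H x)) (blkSK x.toKIdx (sIK x.toKIdx (bI x))) (blkSK x.toKIdx (sIK x.toKIdx (bI x)))
      (sliceProjK (κ := TrIdx N) ν) (fun (a b : (geo9Y x).Site) => (1 : ℝ) * Real.exp (-((δ₃ + σS) * (geo9Y x).dist a b))) :=
    fun ν => blockBd_sliceProjK_any x.toKIdx 1 (H x) (blkSK x.toKIdx (sIK x.toKIdx (bI x))) ν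
  have hcf : x.toKIdx.cf * etaS x.toKIdx = 1 := cf_mul_etaS_of_hcfk x.toKIdx x.hcfk
  have hcard : (Fintype.card (Fin (d + 1)) : ℝ) = ((d + 1 : ℕ) : ℝ) := by rw [Fintype.card_fin]
  have hd1 : ((d + 1 : ℕ) : ℝ) = (d : ℝ) + 1 := by push_cast; ring
  -- (3.49) read for (𝔬12 x)'s letters, R = ϱ(I − P), Pᵀ = P
  have h49p : Proj349Maj (g := geo9Y x) (𝔬12 x).blkW (𝔬12 x).blk
      (PcoK x.toKIdx (trBasis N) (bg9YR (Matrix (Fin N) (Fin N) ℂ) (specialUnitaryUnits (Fin N)) R₁ R₂ x) (fun U => U) (parT x.toKIdx) (GpY x.toKIdx (parT x.toKIdx)) U)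
      ((𝔬12 x).Dv U) ((𝔬12 x).Dvstar U) 1 (H x) CP δP := by
    rw [hblkW12 x, hblk12 x, hDvco12 x U, hDvsco12 x U]; exact h49 x hM1x α₀ hα ha U hU
  have hR : (𝔬12 x).R U = (cR39 (trBasis N))⁻¹ • (LinearMap.id -
      PcoK x.toKIdx (trBasis N) (bg9YR (Matrix (Fin N) (Fin N) ℂ) (specialUnitaryUnits (Fin N)) R₁ R₂ x) (fun U => U) (parT x.toKIdx) (GpY x.toKIdx (parT x.toKIdx)) U) := by
    rw [hRco12 x U, rcoK_GpPhysY, rcoK_eq]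
  -- the displayed law `hsymRT` in place of the parent's `isTransposePair_RcoK` (its proof, at `parT`)
  have hRsym : IsTransposePair
      (RcoK x.toKIdx (trBasis N) (bg9YR (Matrix (Fin N) (Fin N) ℂ) (specialUnitaryUnits (Fin N)) R₁ R₂ x) (fun U => U) (parT x.toKIdx) (GpY x.toKIdx (parT x.toKIdx)) U)
      (RcoK x.toKIdx (trBasis N) (bg9YR (Matrix (Fin N) (Fin N) ℂ) (specialUnitaryUnits (Fin N)) R₁ R₂ x) (fun U => U) (parT x.toKIdx) (GpY x.toKIdx (parT x.toKIdx)) U) :=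
    isTransposePair_smul (isTransposePair_coordOpK_of_isSymmTr (trBasis N) (trBasis_repr_eq_trace N) _ (hsymRT x hM1x α₀ hα ha U hU)) _
  have hPeq : PcoK x.toKIdx (trBasis N) (bg9YR (Matrix (Fin N) (Fin N) ℂ) (specialUnitaryUnits (Fin N)) R₁ R₂ x) (fun U => U) (parT x.toKIdx)
      (GpY x.toKIdx (parT x.toKIdx)) U = 1 - (cR39 (trBasis N)) •
        RcoK x.toKIdx (trBasis N) (bg9YR (Matrix (Fin N) (Fin N) ℂ) (specialUnitaryUnits (Fin N)) R₁ R₂ x) (fun U => U) (parT x.toKIdx) (GpY x.toKIdx (parT x.toKIdx)) U := by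
    rw [rcoK_eq, smul_smul, mul_inv_cancel₀ hc0.ne', one_smul, Module.End.one_eq_id, sub_sub_cancel]
  have hPT : IsTransposePair
      (PcoK x.toKIdx (trBasis N) (bg9YR (Matrix (Fin N) (Fin N) ℂ) (specialUnitaryUnits (Fin N)) R₁ R₂ x) (fun U => U) (parT x.toKIdx) (GpY x.toKIdx (parT x.toKIdx)) U)
      (PcoK x.toKIdx (trBasis N) (bg9YR (Matrix (Fin N) (Fin N) ℂ) (specialUnitaryUnits (Fin N)) R₁ R₂ x) (fun U => U) (parT x.toKIdx) (GpY x.toKIdx (parT x.toKIdx)) U) := by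
    rw [hPeq]; exact isTransposePair_one.sub (isTransposePair_smul hRsym _)
  have hI := h152 x hM1x α₀ hα ha U hU hU'
  have hB₅le : |(x.toKIdx.cf * etaS x.toKIdx) ^ 2| * ((Fintype.card (Fin (d + 1)) : ℝ) * (1 * ((Fintype.card (Fin (d + 1)) : ℝ) *
      (((d : ℝ) + 1) * (CA * CE * c) * c)) * c)) ≤ B₅ := by
    rw [hcf, one_pow, hcard]
  refine ⟨?_, fun μ₀ => ?_⟩
  · -- rgdDs: E = ∇*_U; the word G′∘D*∘∇*_U decomposed at the letters
    have hX : BlockBd (g := toB6 (geo9Y x) 1 (H x)) (𝔬12 x).blkY (𝔬12 x).blkW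
        (GcoS x.toKIdx (trBasis N) (bg9YR (Matrix (Fin N) (Fin N) ℂ) (specialUnitaryUnits (Fin N)) R₁ R₂ x) (fun U => U) (O x) U ∘ₗ (𝔬12 x).Dvstar U ∘ₗ (𝔬12 x).Dstar U)
        (fun (a b : (geo9Y x).Site) => B₅ * Real.exp (-(δ₃ * (geo9Y x).dist a b))) := by
      rw [hblkY12 x, hblkW12 x, hDvsco12 x U, hDsco12 x U]
      exact blockBd_slotWord hG hrowx (GcoS_DvscoKH_DscoK_eq x.toKIdx (trBasis N) (bg9YR (Matrix (Fin N) (Fin N) ℂ) (specialUnitaryUnits (Fin N)) R₁ R₂ x) (fun U => U) (O x) U)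
        hA hE hCp hPr hCA hCE (by positivity) zero_le_one hc hδ₃0 hδ₃5 le_rfl hB₅le
    exact rgdE_of_ids3152 (P := fun U => PcoK x.toKIdx (trBasis N) (bg9YR (Matrix (Fin N) (Fin N) ℂ) (specialUnitaryUnits (Fin N)) R₁ R₂ x) (fun U => U) (parT x.toKIdx)
      (GpY x.toKIdx (parT x.toKIdx)) U) hG hrowx h49p hR hI hPT hX hϱ hCP hB₅ hδ₃0 le_rfl hδ₃P hB₄b
  · -- rgdDd μ₀: E = ∇*_{U,μ₀} on bond functions
    have hX : BlockBd (g := toB6 (geo9Y x) 1 (H x)) (𝔬12 x).blk (𝔬12 x).blkW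
        (GcoS x.toKIdx (trBasis N) (bg9YR (Matrix (Fin N) (Fin N) ℂ) (specialUnitaryUnits (Fin N)) R₁ R₂ x) (fun U => U) (O x) U ∘ₗ (𝔬12 x).Dvstar U ∘ₗ DdsA x U μ₀)
        (fun (a b : (geo9Y x).Site) => B₅ * Real.exp (-(δ₃ * (geo9Y x).dist a b))) := by
      rw [hblk12 x, hblkW12 x, hDvsco12 x U, hDdsA x U]
      exact blockBd_slotWord hG hrowx (GcoS_DvscoKH_DdsB_eq x.toKIdx (trBasis N) (bg9YR (Matrix (Fin N) (Fin N) ℂ) (specialUnitaryUnits (Fin N)) R₁ R₂ x) (fun U => U) (O x) U μ₀)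
        (fun μ _ => hA μ μ₀) hE hCp hPr hCA hCE (by positivity) zero_le_one hc hδ₃0 hδ₃5 le_rfl hB₅le
    exact rgdE_of_ids3152 (P := fun U => PcoK x.toKIdx (trBasis N) (bg9YR (Matrix (Fin N) (Fin N) ℂ) (specialUnitaryUnits (Fin N)) R₁ R₂ x) (fun U => U) (parT x.toKIdx)
      (GpY x.toKIdx (parT x.toKIdx)) U) hG hrowx h49p hR hI hPT hX hϱ hCP hB₅ hδ₃0 le_rfl hδ₃P hB₄b

end Summit.QuantumFields.YangMills.BalabanUVNodes.N06RgdDsLegAtPinsPhysRPar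

end
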